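import Mathlib
import Literature.RingTheory.MvPowerSeries.HasseDerivDiffOp
import Literature.RingTheory.MvPowerSeries.HasseDerivFrobenius
import Summits.ResolutionOfSingularities.ResolutionOfSingularities.Theorems.WeightedInvariantLocalWeightedDropTOT2ConflictBudgetDefs
import Summits.ResolutionOfSingularities.ResolutionOfSingularities.Theorems.WeightedInvariantLocalWeightedDropWildMonicShift

/-!
# TOT2-LINE (P3) brick B5-D3, part 1/3: HASSE DERIVATIVES IN `y` OF THE MONIC GERM ALONG A TOP-LOCUS PRIME and the TAYLOR FORM `(Y − ȳ)^d`

Sub-problem `ResolutionOfSingularities`, ENGINE crux `stmt-ResolutionOfSingularities-8899` (`LocalWeightedDrop`), skeleton v35 (2e806da509994632),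
registered stub `stub_conflictBudget` (P3); dictionary brick B5-D3 `pairVal_lt_top` (split v1.1 of res-L1-w43-stub-2 g6, re-typed by res-L1-w43-plan-1
RULING (D3-retype) 2026-08-27T20:24:41Z; this hand res-L1-w43-stub-1 g7).  [OURS · L1 W4.3 · chain w43.  Engine bookkeeping: nothing here is a
statement of any manuscript; AI-produced, gate-checked, weaker than expert review.  «[OURS · L1 W4.3] replaces the role of nothing printed; NOT a
statement of the manuscript.»]

`R₂ = k⟦u₁,u₂⟧ ⊂ R₃ = k⟦u₁,u₂,y⟧` via `toThree`, `F = monicGerm d A = F̂(y)` with `F̂ = WildMonic.monicPoly d A = Y^d + Σ A_j Y^j ∈ R₂[Y]`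
(`monicGerm_eq_eval₂`).
* §1 HASSE DERIVATIVES (tree `Literature.RingTheory.MvPowerSeries.hasseDeriv`, Leibniz rule `hasseDeriv_mul`): `Δ_α(P^n) ⊆ P^{n−|α|}`
  (`hasseDeriv_mem_pow`); for a prime `P`, `s ∉ P` and `s f ∈ P^n`: `Δ_α f ∈ P` for `|α| < n` (`hasseDeriv_mem_of_mul_mem_pow`); the `y`-derivatives
  of `F̂(y)` are `(Δ_j F̂)(y)` (`hasseDeriv_single_eval₂`), so `(Δ_j F̂)(y) ∈ P` for `j < d` when `s F ∈ P^d` (`eval₂_hasseDeriv_monicPoly_mem`).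
* §2 TAYLOR: a monic polynomial all of whose Hasse derivatives of order `< deg` vanish at `r` is `(Y − r)^deg`
  (`eq_X_sub_C_pow_of_hasseDeriv_eval_eq_zero`); hence `F̂ ≡ (Y − ȳ)^d` in `(R₃ ⧸ P)[Y]` (`map_monicPoly_eq_X_sub_C_pow`).
Parts 2/3 (`…TOT2PlanePolynomials`: reduction of `R₃` modulo `F` to plane polynomials) and 3/3 (`…TOT2PairValFinite`) complete the brick.
-/

set_option linter.dupNamespace false -- mandated namespace of this single-conjunct summit

noncomputable section

namespace Summit.ResolutionOfSingularities.ResolutionOfSingularities.Theorems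

namespace TOT2Branch

open MvPowerSeries IsLocalRing
open Literature.RingTheory.MvPowerSeries (hasseDeriv hasseDeriv_mul hasseDeriv_monomial hasseDeriv_zero coeff_hasseDeriv)

variable {k : Type} [Field k]

/-! ## §0 The monic germ as a polynomial in `y` over the plane -/

/-- The monic germ is the evaluation at `y = X (Fin.last 2)` of `WildMonic.monicPoly d A ∈ k⟦u₁,u₂⟧[Y]` along `toThree`. -/
theorem monicGerm_eq_eval₂ (d : ℕ) (A : Fin d → MvPowerSeries (Fin 2) k) :
    NCPoly.monicGerm d A =
      (WildMonic.monicPoly d A).eval₂ (toThree (k := k) : MvPowerSeries (Fin 2) k →+* MvPowerSeries (Fin 3) k) (X (Fin.last 2)) := by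
  simp only [WildMonic.monicPoly, Polynomial.eval₂_add, Polynomial.eval₂_X_pow, Polynomial.eval₂_finsetSum, Polynomial.eval₂_mul,
    Polynomial.eval₂_C, RingHom.coe_coe]
  rfl

/-- `WildMonic.monicPoly d A` is monic. -/
theorem monic_monicPoly {R : Type*} [CommRing R] [Nontrivial R] (d : ℕ) (A : Fin d → R) : (WildMonic.monicPoly d A).Monic := by
  change (WildMonic.monicPoly d A).leadingCoeff = 1
  rw [Polynomial.leadingCoeff, WildMonic.natDegree_monicPoly, WildMonic.coeff_monicPoly_self]

/-- Plane series are `y`-free: their coefficients vanish at exponents involving `y`. -/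
theorem coeff_toThree_eq_zero (g : MvPowerSeries (Fin 2) k) {e : Fin 3 →₀ ℕ} (he : e (Fin.last 2) ≠ 0) :
    coeff e (toThree g) = 0 := by
  change coeff e (rename (Fin.succAboveEmb (Fin.last 2)) g) = 0
  refine coeff_rename_eq_zero _ _ ?_
  rintro ⟨x, rfl⟩
  exact he (Finsupp.mapDomain_notin_range _ _ (by rintro ⟨i, hi⟩; exact Fin.succAbove_ne _ _ hi))

/-! ## §1 Hasse derivatives and (symbolic) powers of an ideal -/

/-- **`Δ_α (P^n) ⊆ P^{n − |α|}`** (higher Leibniz rule). -/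
theorem hasseDeriv_mem_pow (P : Ideal (MvPowerSeries (Fin 3) k)) :
    ∀ (n : ℕ) {f : MvPowerSeries (Fin 3) k}, f ∈ P ^ n → ∀ α : Fin 3 →₀ ℕ, hasseDeriv α f ∈ P ^ (n - α.degree) := by
  classical
  intro n
  induction n with
  | zero => intro f _ α; rw [Nat.zero_sub, pow_zero, Ideal.one_eq_top]; exact Submodule.mem_top
  | succ n ih =>
    intro f hf
    rw [pow_succ] at hf
    refine Submodule.mul_induction_on hf (fun a ha b hb => ?_) (fun x y hx hy => ?_)
    · intro α
      rw [hasseDeriv_mul]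
      refine Ideal.sum_mem _ fun ab hab => ?_
      rw [Finset.HasAntidiagonal.mem_antidiagonal] at hab
      have ha' := ih ha ab.1
      have hb' : hasseDeriv ab.2 b ∈ P ^ (1 - ab.2.degree) := by
        by_cases h0 : ab.2 = 0
        · rw [h0, hasseDeriv_zero, map_zero, Nat.sub_zero, pow_one]; exact hb
        · have h1 : ab.2.degree ≠ 0 := by rwa [Ne, Finsupp.degree_eq_zero_iff]
          rw [Nat.sub_eq_zero_of_le (Nat.one_le_iff_ne_zero.mpr h1), pow_zero, Ideal.one_eq_top]; exact Submodule.mem_top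
      have hprod := Ideal.mul_mem_mul ha' hb'
      rw [← pow_add] at hprod
      refine Ideal.pow_le_pow_right ?_ hprod
      have hdeg : α.degree = ab.1.degree + ab.2.degree := by rw [← hab, map_add]
      rw [hdeg]
      by_cases h0 : ab.2.degree = 0
      · rw [h0]; omega
      · omega
    · intro α; rw [map_add]; exact Ideal.add_mem _ (hx α) (hy α)

/-- **Hasse derivatives of a SYMBOLIC power**: for a prime `P`, `s ∉ P` and `s f ∈ P^n`, `Δ_α f ∈ P` whenever `|α| < n`
(induction on `|α|` in the Leibniz expansion of `Δ_α (s f)`). -/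
theorem hasseDeriv_mem_of_mul_mem_pow {P : Ideal (MvPowerSeries (Fin 3) k)} (hP : P.IsPrime) {s f : MvPowerSeries (Fin 3) k}
    (hs : s ∉ P) {n : ℕ} (hsf : s * f ∈ P ^ n) : ∀ α : Fin 3 →₀ ℕ, α.degree < n → hasseDeriv α f ∈ P := by
  classical
  suffices h : ∀ N, ∀ α : Fin 3 →₀ ℕ, α.degree = N → N < n → hasseDeriv α f ∈ P from fun α hα => h _ α rfl hα
  intro N
  induction N using Nat.strong_induction_on with
  | _ N ih =>
    intro α hαN hNn
    have hkey : hasseDeriv α (s * f) ∈ P := by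
      have h1 := hasseDeriv_mem_pow P n hsf α
      exact Ideal.pow_le_self (by omega) h1
    have hmem : ((0 : Fin 3 →₀ ℕ), α) ∈ Finset.HasAntidiagonal.antidiagonal α := Finset.HasAntidiagonal.mem_antidiagonal.mpr (zero_add α)
    rw [hasseDeriv_mul, ← Finset.add_sum_erase _ _ hmem, hasseDeriv_zero] at hkey
    have hrest : ∑ ab ∈ (Finset.HasAntidiagonal.antidiagonal α).erase (0, α), hasseDeriv ab.1 s * hasseDeriv ab.2 f ∈ P := by
      refine Ideal.sum_mem _ fun ab hab => ?_
      obtain ⟨hne, hab'⟩ := Finset.mem_erase.mp hab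
      rw [Finset.HasAntidiagonal.mem_antidiagonal] at hab'
      have ha0 : ab.1 ≠ 0 := by
        intro h0
        apply hne
        have h2 : ab.2 = α := by rw [← hab', h0, zero_add]
        exact Prod.ext h0 h2
      have hdeg : ab.2.degree < N := by
        have h1 := congrArg Finsupp.degree hab'
        rw [map_add, hαN] at h1
        have h2 : ab.1.degree ≠ 0 := by rwa [Ne, Finsupp.degree_eq_zero_iff]
        omega
      exact Ideal.mul_mem_left _ _ (ih _ hdeg ab.2 rfl (by omega))
    have h2 : s * hasseDeriv α f ∈ P := by
      have h3 := Ideal.sub_mem _ hkey hrest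
      rwa [add_sub_cancel_right] at h3
    exact (hP.mem_or_mem h2).resolve_left hs

/-- `y`-free series are killed by the Hasse derivatives involving `y`. -/
theorem hasseDeriv_eq_zero_of_noY {g : MvPowerSeries (Fin 3) k} (hg : ∀ e : Fin 3 →₀ ℕ, e (Fin.last 2) ≠ 0 → coeff e g = 0)
    {α : Fin 3 →₀ ℕ} (hα : α (Fin.last 2) ≠ 0) : hasseDeriv α g = 0 := by
  ext β
  rw [coeff_hasseDeriv, map_zero, hg _ (fun h => hα ?_), mul_zero]
  rw [Finsupp.add_apply] at h
  omega

/-- The `y`-Hasse derivatives commute with multiplication by a `y`-free series. -/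
theorem hasseDeriv_single_mul_of_noY {g : MvPowerSeries (Fin 3) k} (hg : ∀ e : Fin 3 →₀ ℕ, e (Fin.last 2) ≠ 0 → coeff e g = 0)
    (j : ℕ) (f : MvPowerSeries (Fin 3) k) :
    hasseDeriv (Finsupp.single (Fin.last 2) j) (g * f) = g * hasseDeriv (Finsupp.single (Fin.last 2) j) f := by
  classical
  have hmem : ((0 : Fin 3 →₀ ℕ), Finsupp.single (Fin.last 2) j) ∈ Finset.HasAntidiagonal.antidiagonal (Finsupp.single (Fin.last 2) j) :=
    Finset.HasAntidiagonal.mem_antidiagonal.mpr (zero_add _)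
  rw [hasseDeriv_mul, ← Finset.add_sum_erase _ _ hmem, hasseDeriv_zero, Finset.sum_eq_zero (fun ab hab => ?_), add_zero]
  obtain ⟨hne, hab'⟩ := Finset.mem_erase.mp hab
  rw [Finset.HasAntidiagonal.mem_antidiagonal] at hab'
  have ha : ab.1 (Fin.last 2) ≠ 0 := by
    intro h0
    apply hne
    have hab1 : ab.1 = 0 := by
      ext i
      have hi := congrArg (fun f : Fin 3 →₀ ℕ => f i) hab'
      simp only [Finsupp.add_apply, Finsupp.single_apply] at hi
      by_cases h : Fin.last 2 = i
      · subst h; simpa using h0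
      · rw [if_neg h] at hi
        simp only [Finsupp.coe_zero, Pi.zero_apply]
        omega
    refine Prod.ext hab1 ?_
    rw [hab1, zero_add] at hab'
    exact hab'
  rw [hasseDeriv_eq_zero_of_noY hg ha, zero_mul]

/-- **`Δ_{y,j} (y^n) = C(n,j) · y^{n−j}`** (and `0` for `j > n`, as `C(n,j) = 0`). -/
theorem hasseDeriv_single_X_pow (j n : ℕ) :
    hasseDeriv (Finsupp.single (Fin.last 2) j) ((X (Fin.last 2) : MvPowerSeries (Fin 3) k) ^ n) =
      (n.choose j : MvPowerSeries (Fin 3) k) * X (Fin.last 2) ^ (n - j) := by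
  classical
  rw [X_pow_eq, hasseDeriv_monomial]
  split_ifs with h
  · rw [Finsupp.single_le_iff, Finsupp.single_eq_same] at h
    have hprod : ((Finsupp.single (Fin.last 2) n).prod fun s m => m.choose ((Finsupp.single (Fin.last 2) j) s)) = n.choose j := by
      by_cases hn : n = 0
      · subst hn
        have hj : j = 0 := Nat.le_zero.mp h
        subst hj
        rw [Finsupp.single_zero, Finsupp.prod_zero_index, Nat.choose_zero_right]
      · rw [Finsupp.prod, Finsupp.support_single _ hn, Finset.prod_singleton, Finsupp.single_eq_same, Finsupp.single_eq_same]
    rw [hprod, ← Finsupp.single_tsub, X_pow_eq, mul_one]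
    ext β
    rw [coeff_monomial, ← map_natCast (C : k →+* MvPowerSeries (Fin 3) k), coeff_C_mul, coeff_monomial]
    split_ifs <;> simp
  · rw [Finsupp.single_le_iff, Finsupp.single_eq_same, not_le] at h
    rw [Nat.choose_eq_zero_of_lt h, Nat.cast_zero, zero_mul]

/-- **The `y`-Hasse derivatives of `g(y)`, `g ∈ k⟦u₁,u₂⟧[Y]`, are the evaluations of the Hasse derivatives of `g`.** -/
theorem hasseDeriv_single_eval₂ (q : Polynomial (MvPowerSeries (Fin 2) k)) (j : ℕ) :
    hasseDeriv (Finsupp.single (Fin.last 2) j)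
        (q.eval₂ (toThree (k := k) : MvPowerSeries (Fin 2) k →+* MvPowerSeries (Fin 3) k) (X (Fin.last 2))) =
      (Polynomial.hasseDeriv j q).eval₂ (toThree (k := k) : MvPowerSeries (Fin 2) k →+* MvPowerSeries (Fin 3) k) (X (Fin.last 2)) := by
  induction q using Polynomial.induction_on' with
  | add p q hp hq => rw [Polynomial.eval₂_add, map_add, hp, hq, map_add, Polynomial.eval₂_add]
  | monomial n r =>
    rw [Polynomial.eval₂_monomial, Polynomial.hasseDeriv_monomial, Polynomial.eval₂_monomial, RingHom.coe_coe,
      hasseDeriv_single_mul_of_noY (fun e he => coeff_toThree_eq_zero r he), hasseDeriv_single_X_pow, map_mul, map_natCast]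
    ring

/-- **The `y`-Hasse derivatives of the monic germ along a top-locus prime**: `s ∉ P`, `s · F ∈ P^d` ⇒ `(Δ_j F̂)(y) ∈ P` for `j < d`. -/
theorem eval₂_hasseDeriv_monicPoly_mem {d : ℕ} {A : Fin d → MvPowerSeries (Fin 2) k} {P : Ideal (MvPowerSeries (Fin 3) k)}
    (hP : P.IsPrime) {s : MvPowerSeries (Fin 3) k} (hs : s ∉ P) (hsF : s * NCPoly.monicGerm d A ∈ P ^ d) {j : ℕ} (hj : j < d) :
    (Polynomial.hasseDeriv j (WildMonic.monicPoly d A)).eval₂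
        (toThree (k := k) : MvPowerSeries (Fin 2) k →+* MvPowerSeries (Fin 3) k) (X (Fin.last 2)) ∈ P := by
  rw [← hasseDeriv_single_eval₂, ← monicGerm_eq_eval₂]
  exact hasseDeriv_mem_of_mul_mem_pow hP hs hsF _ (by rwa [Finsupp.degree_single])

/-! ## §2 Taylor: vanishing Hasse derivatives force `(Y − r)^deg` -/

/-- **A monic polynomial whose Hasse derivatives of order `< deg` all vanish at `r` is `(Y − r)^{deg}`** (Taylor expansion at `r`). -/
theorem eq_X_sub_C_pow_of_hasseDeriv_eval_eq_zero {D : Type*} [CommRing D] (q : Polynomial D) (hq : q.Monic) (r : D)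
    (h : ∀ j < q.natDegree, (Polynomial.hasseDeriv j q).eval r = 0) :
    q = (Polynomial.X - Polynomial.C r) ^ q.natDegree := by
  have hT : Polynomial.taylor r q = Polynomial.X ^ q.natDegree := by
    ext j
    rw [Polynomial.taylor_coeff, Polynomial.coeff_X_pow]
    rcases lt_trichotomy j q.natDegree with hj | hj | hj
    · rw [h j hj, if_neg hj.ne]
    · subst hj
      rw [if_pos rfl]
      have hC : Polynomial.hasseDeriv q.natDegree q = Polynomial.C 1 := by
        ext m
        rw [Polynomial.hasseDeriv_coeff, Polynomial.coeff_C]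
        rcases Nat.eq_zero_or_pos m with hm | hm
        · subst hm; rw [if_pos rfl, zero_add, Nat.choose_self, Nat.cast_one, one_mul]; exact hq.coeff_natDegree
        · rw [if_neg hm.ne', Polynomial.coeff_eq_zero_of_natDegree_lt (by omega), mul_zero]
      rw [hC, Polynomial.eval_C]
    · rw [Polynomial.hasseDeriv_eq_zero_of_lt_natDegree q j hj, Polynomial.eval_zero, if_neg hj.ne']
  calc q = Polynomial.taylor (-r + r) q := by rw [neg_add_cancel, Polynomial.taylor_zero]
    _ = Polynomial.taylor (-r) (Polynomial.taylor r q) := by rw [Polynomial.taylor_taylor]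
    _ = (Polynomial.X - Polynomial.C r) ^ q.natDegree := by
      rw [hT, Polynomial.taylor_apply, Polynomial.X_pow_comp, map_neg, ← sub_eq_add_neg]

/-- **TAYLOR FORM OF THE MONIC GERM ALONG A TOP-LOCUS PRIME**: if `s ∉ P`, `s F ∈ P^d` then `F̂ ≡ (Y − ȳ)^d` in `(R₃ ⧸ P)[Y]`. -/
theorem map_monicPoly_eq_X_sub_C_pow {d : ℕ} {A : Fin d → MvPowerSeries (Fin 2) k} {P : Ideal (MvPowerSeries (Fin 3) k)}
    [hP : P.IsPrime] {s : MvPowerSeries (Fin 3) k} (hs : s ∉ P) (hsF : s * NCPoly.monicGerm d A ∈ P ^ d) :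
    (WildMonic.monicPoly d A).map ((Ideal.Quotient.mk P).comp (toThree (k := k) : MvPowerSeries (Fin 2) k →+* MvPowerSeries (Fin 3) k)) =
      (Polynomial.X - Polynomial.C (Ideal.Quotient.mk P (X (Fin.last 2)))) ^ d := by
  haveI : Nontrivial (MvPowerSeries (Fin 3) k ⧸ P) := Ideal.Quotient.nontrivial_iff.mpr hP.ne_top
  have hmonic := (monic_monicPoly d A).map ((Ideal.Quotient.mk P).comp (toThree (k := k) : MvPowerSeries (Fin 2) k →+* MvPowerSeries (Fin 3) k))
  have hdeg : ((WildMonic.monicPoly d A).map ((Ideal.Quotient.mk P).comp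
      (toThree (k := k) : MvPowerSeries (Fin 2) k →+* MvPowerSeries (Fin 3) k))).natDegree = d := by
    rw [(monic_monicPoly d A).natDegree_map, WildMonic.natDegree_monicPoly]
  have h := eq_X_sub_C_pow_of_hasseDeriv_eval_eq_zero _ hmonic (Ideal.Quotient.mk P (X (Fin.last 2))) (fun j hj => ?_)
  · rwa [hdeg] at h
  · rw [hdeg] at hj
    have hmap : Polynomial.hasseDeriv j ((WildMonic.monicPoly d A).map ((Ideal.Quotient.mk P).comp
        (toThree (k := k) : MvPowerSeries (Fin 2) k →+* MvPowerSeries (Fin 3) k))) =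
        (Polynomial.hasseDeriv j (WildMonic.monicPoly d A)).map ((Ideal.Quotient.mk P).comp
          (toThree (k := k) : MvPowerSeries (Fin 2) k →+* MvPowerSeries (Fin 3) k)) := by
      ext n
      simp only [Polynomial.hasseDeriv_coeff, Polynomial.coeff_map, map_mul, map_natCast]
    rw [hmap, Polynomial.eval_map, ← Polynomial.hom_eval₂, Ideal.Quotient.eq_zero_iff_mem]
    exact eval₂_hasseDeriv_monicPoly_mem hP hs hsF hj

end TOT2Branch

end Summit.ResolutionOfSingularities.ResolutionOfSingularities.Theorems

end
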